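import Summits.BirchSwinnertonDyer.BirchSwinnertonDyer.Theorems.ErratumRoadFiveFittingExtensionInequality
import HarnessLib

/-!
# Route `ErratumRoadFive` (K2), crux (T) `Rest3TorsionBranchAtFive` (item stmt-BirchSwinnertonDyer-19702):
# the END FORM of the (iv)-free congruence road — `Ch_Λ(X) ⊆ (L)` from congruences whose control defect is
# a kernel generated by `n` elements and killed by `π^k`, uniformly in `m`, and `π ∤ L` (memo §31.3, all
# steps (1)–(8) except the Selmer-group identifications, in ONE theorem with module-theoretic hypotheses)

Cell `bsd-stepL` (run/shared/lean/pub/bsd-stepL/), seat `bsd-stepL-bdp` (prover g13, 2026-08-26), memo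
`HOME/proof/PROOF-BDP.md` §31; `--supports stmt-BirchSwinnertonDyer-19702 --as helper`. Composition of
p457703 (`BoundedCongruenceLimit`, the defect-tolerant limit + cancellation) and p459257
(`FittingExtension`, Stacks 07ZA (4) + (2)).

HONEST FRAMING: PURE COMMUTATIVE ALGEBRA (theorems only; no definition, no named fact, no `sorry`); the
binders are abstract modules and maps — that they are instantiated by `X^Σ_ac(E[p^∞])`, `X^Σ_ac(A_{g_m})`,
the dual residual Selmer groups and the control defects of memo §31.2 is NOT asserted here (the tree does
not construct the residual Selmer groups `Sel^Σ_𝔭(K, M[ϖ^m])`); nothing is booked; BSD is advanced for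
no class; no census word, tier or label moves (T7).

Dictionary (memo §31.3): `R = Λ = 𝒪⟦T⟧` (`𝒪 = 𝒪^{ur}` a complete DVR, `I = (ϖ)`), `M = X^Σ_ac(E[p^∞])`,
`N m = X^Σ_ac(A_{g_m})`, `Q m = Sel^Σ_𝔭(K, M_E[ϖ^m])^∨ ≅ Sel^Σ_𝔭(K, M_{g_m}[ϖ^m])^∨` [(b)],
`α m : M ↠ Q m` [dual of `Sel(M_E[ϖ^m]) ↪ Sel(M_E)[ϖ^m]`, Lemma 2.1 without the vanishing],
`Kd m → N m/I^m ↠ Q m` exact [dual of `Sel(M_g[ϖ^m]) ↪ Sel(M_g)[ϖ^m] ↠ defect ↪ H⁰(K_𝔭, M_g)/ϖ^m`],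
`Kd m` generated by `n = c₀` elements and killed by `π^k` (`π = ϖ`; memo §31.2 (L1): `#H⁰(K_𝔭, M) ≤
p^{c₀}`, exponent `p^k`, INDEPENDENT of `m`), `Lm m = L^Σ_p(g_m)`, `L = L^Σ_p(f)`; `hCh` = (2.5) for `g_m`
[FW21 4.41 ∘ FO12 ∘ CGS23 1.4.5 ∘ JSW17 3.4.2], `hc` = (c) [Cas20 2.11], `hT`/`hnf` = control + Lemma
2.2 for `f`, `hL` = `ϖ ∤ L` (`μ = 0`, after Σ-removal — memo §31.3 (6)–(7)).

References: [Castella2018Erratum] Lemma 2.1, proof of Thm. 1.1 (pp. 2, 4); [StacksProject] Tag 07ZA;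
[Skinner2016PacificMC] §3.1; memo §31.
-/

set_option autoImplicit false
-- the Theorems namespace of this sub repeats the summit name by design (D-0017 nested layout)
set_option linter.dupNamespace false

noncomputable section

open Literature.RingTheory.FittingIdeal Literature.NumberTheory.EllipticCurves
  Literature.NumberTheory.EllipticCurves.Module PowerSeries IsDiscreteValuationRing IsLocalRing
  Summit.BirchSwinnertonDyer.Rank1Residual.X11b.CongruenceLimit

namespace Summit.BirchSwinnertonDyer.BirchSwinnertonDyer.Theorems.BoundedCongruenceLimit

open Summit.BirchSwinnertonDyer.BirchSwinnertonDyer.Theorems.FittingExtension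

universe u

/-! ### §1 The defect binder from a bounded kernel (any commutative ring) -/

/-- **The defect binder `hD` of `mul_fittingIdeal_le_span_of_congruences` from a BOUNDED KERNEL.** If
`Kd —ι→ N/I^mN —β→ Q → 0` is exact with `β` onto, `Kd` generated by `n` elements and killed by `d`,
then `(d^n)·Fitt₀(Q) ⊆ Fitt₀(N) + I^m` (Stacks 07ZA (4)+(2) via `FittingExtension`, then reduction
modulo `I^m`). [cite: StacksProject, Tag 07ZA (2), (3), (4)] -/
theorem defect_le_sup_of_boundedKernel {R : Type u} [CommRing R] (I : Ideal R) (m : ℕ)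
    {N Q Kd : Type*} [AddCommGroup N] [Module R N] [Module.Finite R N] [AddCommGroup Q] [Module R Q]
    [Module.Finite R Q] [AddCommGroup Kd] [Module R Kd]
    (ι : Kd →ₗ[R] (N ⧸ (I ^ m • (⊤ : Submodule R N)))) (β : (N ⧸ (I ^ m • (⊤ : Submodule R N))) →ₗ[R] Q)
    (hex : Function.Exact ι β) (hβ : Function.Surjective β)
    {n : ℕ} (hgen : ∃ κ : Fin n → Kd, Submodule.span R (Set.range κ) = ⊤)
    {d : R} (hd : d ∈ Module.annihilator R Kd) :
    Ideal.span {d ^ n} * Module.fittingIdeal R Q 0 ≤ Module.fittingIdeal R N 0 ⊔ I ^ m :=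
  defect_le_sup_of_le_quotient I (Ideal.span {d ^ n}) m N Q
    (span_pow_mul_fittingIdeal_zero_le_of_exact ι β hex hβ hgen hd)

/-! ### §2 The end form over `Λ_𝒪 = 𝒪⟦T⟧` with a bounded kernel -/

section PowerSeriesDVR

open Summit.BirchSwinnertonDyer.Rank1Residual.X11b.CongruenceLimit.PowerSeriesDVR

variable {𝒪 : Type} [CommRing 𝒪] [IsDomain 𝒪] [IsDiscreteValuationRing 𝒪]
  [IsAdicComplete (maximalIdeal 𝒪) 𝒪]

/-- **`Ch_Λ(M) ⊆ (L)` from congruences with a BOUNDED KERNEL and `π ∤ L` — the (iv)-free erratum road,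
algebraic skeleton in one statement** (memo §31.3). For every `m ≥ 1`: `α_m : M ↠ Q_m`; an exact
`Kd_m → N_m/I^mN_m ↠ Q_m` whose kernel term `Kd_m` is generated by `n` elements and killed by `π^k`
(`n`, `k` INDEPENDENT of `m`); `Ch(N_m) ⊆ (L_m)` when `N_m` is torsion; `(L_m) + I^m = (L) + I^m`; and
`M` torsion with no non-zero finite-length submodule, `π` prime with `π ∤ L`. THEN
`Fitt_Λ(M) = Ch_Λ(M) ⊆ (L)`. With `k = 0` (no defect: `Kd_m = 0`, `n = 0`) the kernel hypotheses say
`N_m/I^m ≅ Q_m` and this is the exact road. Pure algebra; CONDITIONAL on nothing; deletes nothing.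
[cite: Castella2018Erratum, proof of Thm. 1.1 (p. 4), read one-sidedly and without (iv)]
[cite: StacksProject, Tag 07ZA (2), (3), (4)] [cite: Skinner2016PacificMC, §3.1 (p. 192)] -/
theorem charIdeal_le_span_of_congruences_boundedKernel
    {M : Type} [AddCommGroup M] [Module (PowerSeries 𝒪) M] [Module.Finite (PowerSeries 𝒪) M]
    (N : ℕ → Type) [∀ m, AddCommGroup (N m)] [∀ m, Module (PowerSeries 𝒪) (N m)]
    [∀ m, Module.Finite (PowerSeries 𝒪) (N m)]
    (Q : ℕ → Type) [∀ m, AddCommGroup (Q m)] [∀ m, Module (PowerSeries 𝒪) (Q m)]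
    [∀ m, Module.Finite (PowerSeries 𝒪) (Q m)]
    (Kd : ℕ → Type) [∀ m, AddCommGroup (Kd m)] [∀ m, Module (PowerSeries 𝒪) (Kd m)]
    (I : Ideal (PowerSeries 𝒪)) (hI : I ≤ (⊥ : Ideal (PowerSeries 𝒪)).jacobson)
    {L π : PowerSeries 𝒪} (hπ : Prime π) (hL : ¬ π ∣ L) (k n : ℕ) (Lm : ℕ → PowerSeries 𝒪)
    (α : ∀ m : ℕ, 1 ≤ m → (M →ₗ[PowerSeries 𝒪] Q m))
    (hα : ∀ (m : ℕ) (hm : 1 ≤ m), Function.Surjective (α m hm))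
    (ι : ∀ m : ℕ, 1 ≤ m →
      (Kd m →ₗ[PowerSeries 𝒪] (N m ⧸ (I ^ m • (⊤ : Submodule (PowerSeries 𝒪) (N m))))))
    (β : ∀ m : ℕ, 1 ≤ m →
      ((N m ⧸ (I ^ m • (⊤ : Submodule (PowerSeries 𝒪) (N m)))) →ₗ[PowerSeries 𝒪] Q m))
    (hex : ∀ (m : ℕ) (hm : 1 ≤ m), Function.Exact (ι m hm) (β m hm))
    (hβ : ∀ (m : ℕ) (hm : 1 ≤ m), Function.Surjective (β m hm))
    (hgen : ∀ (m : ℕ), 1 ≤ m →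
      ∃ κ : Fin n → Kd m, Submodule.span (PowerSeries 𝒪) (Set.range κ) = ⊤)
    (hkill : ∀ (m : ℕ), 1 ≤ m → π ^ k ∈ Module.annihilator (PowerSeries 𝒪) (Kd m))
    (hCh : ∀ m : ℕ, 1 ≤ m → Module.IsTorsion (PowerSeries 𝒪) (N m) →
      charIdeal (PowerSeries 𝒪) (N m) ≤ Ideal.span {Lm m})
    (hc : ∀ m : ℕ, 1 ≤ m → Ideal.span {Lm m} ⊔ I ^ m = Ideal.span {L} ⊔ I ^ m)
    (hT : Module.IsTorsion (PowerSeries 𝒪) M)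
    (hnf : ∀ N' : Submodule (PowerSeries 𝒪) M, Module.length (PowerSeries 𝒪) N' ≠ ⊤ → N' = ⊥) :
    Module.fittingIdeal (PowerSeries 𝒪) M 0 = charIdeal (PowerSeries 𝒪) M ∧
      charIdeal (PowerSeries 𝒪) M ≤ Ideal.span {L} := by
  refine charIdeal_le_span_of_congruences_defect N Q I hI hπ hL (k * n) Lm α hα
    (fun m hm => ?_) hCh hc hT hnf
  rw [pow_mul]
  exact defect_le_sup_of_boundedKernel I m (ι m hm) (β m hm) (hex m hm) (hβ m hm) (hgen m hm)
    (hkill m hm)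

/-- **At the trivial character, bounded-kernel form**: under the same inputs, for any generator `f_ac` of
`Ch_Λ(M)`, `ord L(0) ≤ ord f_ac(0)` — route p2's `IMCLowerAtTrivialChar` shape, i.e. STEP L once
(BDP)∘(CTL)∘(TAM) are applied, WITHOUT the erratum's hypothesis (iv). [cite: Castella2018Erratum, proof of Thm. 1.1 (p. 4), read one-sidedly and without (iv)]
[cite: JetchevSkinnerWan2017, §7.4.1] -/
theorem addVal_constantCoeff_le_of_congruences_boundedKernel
    {M : Type} [AddCommGroup M] [Module (PowerSeries 𝒪) M] [Module.Finite (PowerSeries 𝒪) M]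
    (N : ℕ → Type) [∀ m, AddCommGroup (N m)] [∀ m, Module (PowerSeries 𝒪) (N m)]
    [∀ m, Module.Finite (PowerSeries 𝒪) (N m)]
    (Q : ℕ → Type) [∀ m, AddCommGroup (Q m)] [∀ m, Module (PowerSeries 𝒪) (Q m)]
    [∀ m, Module.Finite (PowerSeries 𝒪) (Q m)]
    (Kd : ℕ → Type) [∀ m, AddCommGroup (Kd m)] [∀ m, Module (PowerSeries 𝒪) (Kd m)]
    (I : Ideal (PowerSeries 𝒪)) (hI : I ≤ (⊥ : Ideal (PowerSeries 𝒪)).jacobson)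
    {L π : PowerSeries 𝒪} (hπ : Prime π) (hL : ¬ π ∣ L) (k n : ℕ) (Lm : ℕ → PowerSeries 𝒪)
    (α : ∀ m : ℕ, 1 ≤ m → (M →ₗ[PowerSeries 𝒪] Q m))
    (hα : ∀ (m : ℕ) (hm : 1 ≤ m), Function.Surjective (α m hm))
    (ι : ∀ m : ℕ, 1 ≤ m →
      (Kd m →ₗ[PowerSeries 𝒪] (N m ⧸ (I ^ m • (⊤ : Submodule (PowerSeries 𝒪) (N m))))))
    (β : ∀ m : ℕ, 1 ≤ m →
      ((N m ⧸ (I ^ m • (⊤ : Submodule (PowerSeries 𝒪) (N m)))) →ₗ[PowerSeries 𝒪] Q m))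
    (hex : ∀ (m : ℕ) (hm : 1 ≤ m), Function.Exact (ι m hm) (β m hm))
    (hβ : ∀ (m : ℕ) (hm : 1 ≤ m), Function.Surjective (β m hm))
    (hgen : ∀ (m : ℕ), 1 ≤ m →
      ∃ κ : Fin n → Kd m, Submodule.span (PowerSeries 𝒪) (Set.range κ) = ⊤)
    (hkill : ∀ (m : ℕ), 1 ≤ m → π ^ k ∈ Module.annihilator (PowerSeries 𝒪) (Kd m))
    (hCh : ∀ m : ℕ, 1 ≤ m → Module.IsTorsion (PowerSeries 𝒪) (N m) →
      charIdeal (PowerSeries 𝒪) (N m) ≤ Ideal.span {Lm m})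
    (hc : ∀ m : ℕ, 1 ≤ m → Ideal.span {Lm m} ⊔ I ^ m = Ideal.span {L} ⊔ I ^ m)
    (hT : Module.IsTorsion (PowerSeries 𝒪) M)
    (hnf : ∀ N' : Submodule (PowerSeries 𝒪) M, Module.length (PowerSeries 𝒪) N' ≠ ⊤ → N' = ⊥)
    {fac : PowerSeries 𝒪} (hfac : charIdeal (PowerSeries 𝒪) M = Ideal.span {fac}) :
    addVal 𝒪 (constantCoeff L) ≤ addVal 𝒪 (constantCoeff fac) := by
  have h := (charIdeal_le_span_of_congruences_boundedKernel N Q Kd I hI hπ hL k n Lm α hα ι β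
    hex hβ hgen hkill hCh hc hT hnf).2
  rw [hfac] at h
  exact addVal_constantCoeff_le_of_span_le h

end PowerSeriesDVR

end Summit.BirchSwinnertonDyer.BirchSwinnertonDyer.Theorems.BoundedCongruenceLimit

end
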